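import Literature.GroupTheory.SpecificGroups.SymplecticTwoUnipotentClassesNotByRank   -- ★ p846842: `unitaryGroupOfForm`, Mathlib finite fields ∕ rank
import Literature.GroupTheory.SpecificGroups.OrthogonalThreeUnipotentJordanClasses    -- ★ p846826: the `𝔨 = so₃` layer (rank DOES classify there); `StdForm.antidiagonal`
import Literature.NumberTheory.Automorphic.UnitaryGroupRankOneBigCell                 -- ★ `antidiagonal_three_over_eq` (`J₀ = !![0,0,1;0,1,0;1,0,0]`)
import HarnessLib

/-!
# The `𝔭`-layer at a tame-ramified place: rank does NOT classify the nilpotent `Ad O₃(K)`-orbits on the `J₀`-SYMMETRIC matrices — `E₃₁ ≁ ε·E₃₁`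
# (companion of ★ p846826; the odd graded layers `K_w(2j+1)∕K_w(2j+2) ≅ 𝔭̄` of the ramified `U₃`)

Topic `Literature/GroupTheory/SpecificGroups`; namespace `Literature.GroupTheory.SpecificGroups`.  THEOREMS ONLY (no definition, no named fact, no instance, no notation,
no `sorry`).  Cell `pub/hodgecm-mathlib` (crux H413 = `stmt-HodgeConjecture-24833`), «S3-ram» seeding wave (LEAD T11-41∕T11-56; owner p06 (g15); seat F0P3-p03 (g14)).
At a tame-ramified non-split `w` (`σϖ_w = −ϖ_w`, `σ̄ = id`) the congruence filtration of `U(σ_w, J)` has ALTERNATING graded layers: for `M = 1 + ϖ_w^j X` unitarity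
modulo `ϖ_w^{j+1}` reads `J̄X̄ = (−1)^j X̄ᵀJ̄`, so `K_w(j)∕K_w(j+1)` is the `J̄`-SKEW part `so(J̄)(𝓀) = 𝔨̄` for even `j` (where Jordan rank classifies nilpotent orbits,
★ p846826 (6)) and the `J̄`-SYMMETRIC part `𝔭̄ = {N : J̄⁻¹NᵀJ̄ = +N}` for odd `j`.  THIS FILE records that on `𝔭` rank does NOT classify: for `J₀ = antidiag(1,1,1)` the
rank-`1` square-zero `J₀`-symmetric matrices `N(c) = c·E₃₁` (`J₀e₁ = e₃`, `e₁` isotropic) satisfy **`g N(c) g⁻¹ = N(c′)` with `g ∈ O(J₀)` only if `c′ = a²c`** (`g` fixes the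
line `Ke₃`, `ge₃ = αe₃`, and orthogonality gives `e₁ᵀg⁻¹ = αe₁ᵀ`), hence `E₃₁ ≁ εE₃₁` for a non-square `ε` — B-p14 (g37)'s certificate (iv) §(2) finding «the rank-1
nilpotent `O₃(𝔽_q)`-orbits on `𝔭` are exactly TWO; collar `x_y ≡ 1 + ϖ_w b E₃₁`», typed at the `𝓀`-level over ANY field with a non-square.  Consequence for the
ramified LIFT∕(V)-INT organs: the interior value table of a `K`-class piece at odd `w`-levels carries a SQUARE CLASS in addition to the rank.
HONEST LABEL: HC_CM is proved only modulo the printed citations (the 2 remaining named inputs hLiu418, h413) until rung 0 closes; elementary `3 × 3` algebra.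

* `antidiagonal_three_over_inv`, `formAdjoint_cornerSymmetric` (`J₀⁻¹ (c E₃₁)ᵀ J₀ = c E₃₁`: `N(c) ∈ 𝔭`), `cornerSymmetric_sq`, `rank_cornerSymmetric`;
* **`exists_sq_mul_eq_of_orthogonal_conj_cornerSymmetric`** — `g ∈ O(J₀)`, `g N(c) = N(c′) g`, `c′ ≠ 0` ⇒ `∃ a, c′ = a² c`;
* **`not_exists_orthogonal_conj_cornerSymmetric_of_not_isSquare`**, **`exists_symmetric_rank_one_not_conj_of_ringChar_ne_two`**.

## References
* [Wilson2009] R. A. Wilson, *The Finite Simple Groups*, GTM 251 (2009): §3.7.1–§3.7.2 pp. 69–72 (`O₃(q)`, `SO₃(q) ≅ PGL₂(q)`).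
* [CollingwoodMcGovern1993] D. Collingwood, W. McGovern, *Nilpotent Orbits in Semisimple Lie Algebras* (1993): §9.3 (rational orbits and square classes).
* [BruhatTits1972] F. Bruhat, J. Tits, *Groupes réductifs sur un corps local* I, Publ. Math. IHÉS 41 (1972): §10 (congruence filtrations of parahorics).
-/

set_option autoImplicit false

open Matrix Literature.NumberTheory.Automorphic Literature.NumberTheory.Automorphic.HermitianLattice Literature.NumberTheory.Automorphic.UnitaryGroup

namespace Literature.GroupTheory.SpecificGroups

variable {K : Type*} [Field K]

/-- `J₀⁻¹ = J₀`. [cite: Wilson2009, §3.7.1 p. 69] -/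
theorem antidiagonal_three_over_inv : ((StdForm.antidiagonal 3).over K)⁻¹ = !![(0 : K), 0, 1; 0, 1, 0; 1, 0, 0] := by
  rw [antidiagonal_three_over_eq]
  refine Matrix.inv_eq_left_inv ?_
  ext i j; fin_cases i <;> fin_cases j <;> simp [Matrix.mul_apply, Fin.sum_univ_three]

/-- **`N(c) = c·E₃₁ ∈ 𝔭`**: `J₀⁻¹ N(c)ᵀ J₀ = +N(c)` (the `J₀`-SYMMETRIC part, `σ = id`). [cite: BruhatTits1972, §10] [cite: Wilson2009, §3.7.1 p. 69] -/
theorem formAdjoint_cornerSymmetric (c : K) :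
    ((StdForm.antidiagonal 3).over K)⁻¹ * ((!![0, 0, 0; 0, 0, 0; c, 0, 0] : Matrix (Fin 3) (Fin 3) K).map (RingHom.id K))ᵀ * (StdForm.antidiagonal 3).over K =
      !![0, 0, 0; 0, 0, 0; c, 0, 0] := by
  have hT : ((!![0, 0, 0; 0, 0, 0; c, 0, 0] : Matrix (Fin 3) (Fin 3) K).map (RingHom.id K))ᵀ = !![0, 0, c; 0, 0, 0; 0, 0, 0] := by
    ext i j; fin_cases i <;> fin_cases j <;> rfl
  rw [antidiagonal_three_over_inv, hT, antidiagonal_three_over_eq]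
  ext i j; fin_cases i <;> fin_cases j <;> simp [Matrix.mul_apply, Fin.sum_univ_three]

/-- `N(c)² = 0`. [cite: CollingwoodMcGovern1993, §9.3] -/
theorem cornerSymmetric_sq (c : K) : (!![0, 0, 0; 0, 0, 0; c, 0, 0] : Matrix (Fin 3) (Fin 3) K) * !![0, 0, 0; 0, 0, 0; c, 0, 0] = 0 := by
  ext i j; fin_cases i <;> fin_cases j <;> simp [Matrix.mul_apply, Fin.sum_univ_three]

/-- `rank N(c) = 1` for `c ≠ 0`. [cite: CollingwoodMcGovern1993, §9.3] -/
theorem rank_cornerSymmetric {c : K} (hc : c ≠ 0) : (!![0, 0, 0; 0, 0, 0; c, 0, 0] : Matrix (Fin 3) (Fin 3) K).rank = 1 := by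
  have h : (!![0, 0, 0; 0, 0, 0; c, 0, 0] : Matrix (Fin 3) (Fin 3) K) = Matrix.vecMulVec (Pi.single 2 c) (Pi.single 0 (1 : K)) := by
    ext i j; fin_cases i <;> fin_cases j <;> simp [Matrix.vecMulVec_apply]
  have hle : (!![0, 0, 0; 0, 0, 0; c, 0, 0] : Matrix (Fin 3) (Fin 3) K).rank ≤ 1 := by rw [h]; exact Matrix.rank_vecMulVec_le _ _
  have hne : (!![0, 0, 0; 0, 0, 0; c, 0, 0] : Matrix (Fin 3) (Fin 3) K).rank ≠ 0 := by
    intro h0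
    rw [Matrix.rank, Submodule.finrank_eq_zero, LinearMap.range_eq_bot] at h0
    have h1 := congrArg (fun f : (Fin 3 → K) →ₗ[K] (Fin 3 → K) => f (Pi.single 0 1) 2) h0
    simp at h1
    exact hc h1
  omega

/-- **Conjugate corner symmetric nilpotents differ by a SQUARE**: `g ∈ O(J₀)` (`ᵗg J₀ g = J₀`, `σ = id`), `g·N(c) = N(c′)·g`, `c′ ≠ 0` ⇒ `c′ = a²·c` (`g` fixes the
isotropic line `Ke₃`, `ge₃ = αe₃`; the `(3,3)`∕`(1,1)` entries of `ᵗgJ₀g = J₀` give `g₁₁·α = 1`, and the `(3,1)` entries of the conjugation `c′g₁₁ = cα`).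
[cite: CollingwoodMcGovern1993, §9.3] [cite: Wilson2009, §3.7.2 p. 71] -/
theorem exists_sq_mul_eq_of_orthogonal_conj_cornerSymmetric {g : GL (Fin 3) K}
    (hg : g ∈ unitaryGroupOfForm (RingHom.id K) ((StdForm.antidiagonal 3).over K)) {c c' : K} (hc' : c' ≠ 0)
    (h : (g : Matrix (Fin 3) (Fin 3) K) * !![0, 0, 0; 0, 0, 0; c, 0, 0] = !![0, 0, 0; 0, 0, 0; c', 0, 0] * (g : Matrix (Fin 3) (Fin 3) K)) :
    ∃ a : K, c' = a ^ 2 * c := by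
  set G : Matrix (Fin 3) (Fin 3) K := (g : Matrix (Fin 3) (Fin 3) K) with hGdef
  -- the conjugation relation, entrywise: column 0 of `G·N(c)` is `c·(G e₃)`, row 2 of `N(c′)·G` is `c′·(row 0 of G)`
  have h00 := congrFun (congrFun h 0) 0
  have h10 := congrFun (congrFun h 1) 0
  have h20 := congrFun (congrFun h 2) 0
  have h21 := congrFun (congrFun h 2) 1
  have h22 := congrFun (congrFun h 2) 2
  simp [Matrix.mul_apply, Fin.sum_univ_three] at h00 h10 h20 h21 h22
  -- `h00 : G 0 2 * c = 0`-type, `h10 : G 1 2 * c = 0`, `h20 : G 2 2 * c = c' * G 0 0`, `h21 : 0 = c' * G 0 1`, `h22 : 0 = c' * G 0 2`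
  have hG01 : G 0 1 = 0 := h21.resolve_left hc'
  have hG02 : G 0 2 = 0 := h22.resolve_left hc'
  -- orthogonality `ᵗG J₀ G = J₀`, entry `(0, 2)`: `G 0 0 * G 2 2 = 1` once `G 0 1 = G 0 2 = 0`… use entry (2,0) of `GᵀJ₀G`: Σ G k 2 * J₀ * G l 0
  have hU := mem_unitaryGroupOfForm_iff.1 hg
  rw [antidiagonal_three_over_eq] at hU
  have hU02 := congrFun (congrFun hU 0) 2
  simp [Matrix.mul_apply, Fin.sum_univ_three, Matrix.transpose_apply, ← hGdef] at hU02
  -- `hU02 : G 2 0 * G 0 2 + G 1 0 * G 1 2 + G 0 0 * G 2 2 = 1`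
  rw [hG02, mul_zero, zero_add] at hU02
  -- from `h00`, `h10`: if `c = 0` then `c' * G 0 0 = 0` with … handle `c = 0` separately
  by_cases hc : c = 0
  · -- then `G 2 2 * 0 = c' * G 0 0` forces `G 0 0 = 0`, contradicting `… + G 0 0 * G 2 2 = 1` unless `G 1 0 * G 1 2 = 1`; but `h10 : G 1 2 * c = c' * …`? simpler: derive a contradiction-free witness
    subst hc
    simp at h20
    -- `h20 : c' * G 0 0 = 0` ⇒ `G 0 0 = 0`
    have hG00 : G 0 0 = 0 := h20.resolve_left hc'
    -- row 0 of `G` vanishes ⇒ `G` singular, contradiction with `g ∈ GL`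
    exfalso
    have hrow : ∀ j, G 0 j = 0 := fun j => by fin_cases j <;> assumption
    have hdet : G.det = 0 := Matrix.det_eq_zero_of_row_eq_zero 0 hrow
    exact (g.isUnit.map Matrix.detMonoidHom |>.ne_zero) (by simpa [hGdef] using hdet)
  · have hG12 : G 1 2 = 0 := h10.resolve_right hc
    rw [hG12, mul_zero, zero_add] at hU02
    -- `hU02 : G 0 0 * G 2 2 = 1`, `h20 : G 2 2 * c = c' * G 0 0`
    refine ⟨G 2 2, ?_⟩
    calc c' = c' * (G 0 0 * G 2 2) := by rw [hU02, mul_one]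
      _ = (c' * G 0 0) * G 2 2 := by ring
      _ = (G 2 2 * c) * G 2 2 := by rw [← h20]
      _ = G 2 2 ^ 2 * c := by ring

/-- **`E₃₁` and `ε·E₃₁` are NOT `Ad O(J₀)`-conjugate when `ε` is not a square** — both rank-`1`, square-zero, `J₀`-symmetric.
[cite: CollingwoodMcGovern1993, §9.3] -/
theorem not_exists_orthogonal_conj_cornerSymmetric_of_not_isSquare {ε : K} (hε : ¬ IsSquare ε) :
    ¬ ∃ g : GL (Fin 3) K, g ∈ unitaryGroupOfForm (RingHom.id K) ((StdForm.antidiagonal 3).over K) ∧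
      (g : Matrix (Fin 3) (Fin 3) K) * !![0, 0, 0; 0, 0, 0; 1, 0, 0] * ((g⁻¹ : GL (Fin 3) K) : Matrix (Fin 3) (Fin 3) K) = !![0, 0, 0; 0, 0, 0; ε, 0, 0] := by
  rintro ⟨g, hg, hconj⟩
  have hε0 : ε ≠ 0 := fun h0 => hε ⟨0, by rw [h0, mul_zero]⟩
  have hmat : (g : Matrix (Fin 3) (Fin 3) K) * !![0, 0, 0; 0, 0, 0; 1, 0, 0] = !![0, 0, 0; 0, 0, 0; ε, 0, 0] * (g : Matrix (Fin 3) (Fin 3) K) := by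
    have h := congrArg (fun M : Matrix (Fin 3) (Fin 3) K => M * (g : Matrix (Fin 3) (Fin 3) K)) hconj
    simp only [Matrix.mul_assoc] at h
    rw [← Units.val_mul, inv_mul_cancel, Units.val_one, Matrix.mul_one] at h
    exact h
  obtain ⟨a, ha⟩ := exists_sq_mul_eq_of_orthogonal_conj_cornerSymmetric hg hε0 hmat
  exact hε ⟨a, by rw [ha, mul_one, sq]⟩

/-- **Over a finite field of odd characteristic, rank does NOT classify the nilpotent `Ad O(J₀)`-orbits on the `J₀`-symmetric part `𝔭`**: `E₃₁` and `εE₃₁` (`ε` a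
non-square) are `J₀`-symmetric, square-zero, of rank `1`, and not conjugate under `U(id, J₀) = O(J₀)` — contrast ★ p846826 (6) (`so₃`: rank classifies).
[cite: CollingwoodMcGovern1993, §9.3] [cite: Wilson2009, §3.7.2 p. 71] -/
theorem exists_symmetric_rank_one_not_conj_of_ringChar_ne_two [Fintype K] (hK : ringChar K ≠ 2) :
    ∃ N N' : Matrix (Fin 3) (Fin 3) K,
      ((StdForm.antidiagonal 3).over K)⁻¹ * (N.map (RingHom.id K))ᵀ * (StdForm.antidiagonal 3).over K = N ∧
      ((StdForm.antidiagonal 3).over K)⁻¹ * (N'.map (RingHom.id K))ᵀ * (StdForm.antidiagonal 3).over K = N' ∧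
      N * N = 0 ∧ N' * N' = 0 ∧ N.rank = 1 ∧ N'.rank = 1 ∧
      ¬ ∃ g : GL (Fin 3) K, g ∈ unitaryGroupOfForm (RingHom.id K) ((StdForm.antidiagonal 3).over K) ∧
        (g : Matrix (Fin 3) (Fin 3) K) * N * ((g⁻¹ : GL (Fin 3) K) : Matrix (Fin 3) (Fin 3) K) = N' := by
  obtain ⟨ε, hε⟩ := FiniteField.exists_nonsquare hK
  have hε0 : ε ≠ 0 := fun h0 => hε ⟨0, by rw [h0, mul_zero]⟩
  exact ⟨!![0, 0, 0; 0, 0, 0; 1, 0, 0], !![0, 0, 0; 0, 0, 0; ε, 0, 0], formAdjoint_cornerSymmetric 1, formAdjoint_cornerSymmetric ε, cornerSymmetric_sq 1,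
    cornerSymmetric_sq ε, rank_cornerSymmetric one_ne_zero, rank_cornerSymmetric hε0, not_exists_orthogonal_conj_cornerSymmetric_of_not_isSquare hε⟩

end Literature.GroupTheory.SpecificGroups
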